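import Literature.NumberTheory.EllipticCurves.BinaryQuarticPadicOrbitMass
import HarnessLib

/-!
# The `p`-adic change of measure for functions: `∫_{V_{ℤ_p}} Φ dμ_p = |1/27|_p (1 − p⁻²) ∫ Σ_{orbits O, (I,J)(O) = (I,J)} Φ(O)/#Aut_{ℤ_p}(O) dI dJ`
# (Bhargava–Shankar, Props. 3.11–3.12: the orbit form, on one tube and on all of `V_{ℤ_p}`)

`Proofs` companion (theorems only: no definitions, no named facts) of
`BinaryQuarticPadicTubeVolume.lean`, whose main theorem `BinaryQuartic.setLIntegral_autCard_tube` is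
the set form of the `p`-adic change of measure on one orbit tube `U_r = GL₂(ℤ_p) · S_r`:
`∫⁻_A #Aut_{ℤ_p} dμ_p = (1 − p⁻²)|1/27|_p · vol₂((I,J)(A ∩ S_r))` for invariant measurable `A ⊆ U_r`,
and of `BinaryQuarticPadicOrbitMass.lean` (good tubes about every form with `Δ ≠ 0`, a countable
cover of `{Δ ≠ 0}` by good tubes and its disjoint invariant pieces).

Source. M. Bhargava, A. Shankar, *Binary quartic forms having bounded invariants, and the
boundedness of the average rank of elliptic curves*, Ann. of Math. (2) 181 (2015) 191–242,
Props. 3.11–3.12 of the published version (= the "Jacobian change of variables" in the proof of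
Prop. 5.12 of the held text `arXiv:1006.1002v2`, p. 33: "`∫_{f ∈ B_p^F} (1/#Aut(f)) df =
|2¹⁰·2/27|_p Vol(PGL₂(ℤ_p)) ∫_{(I,J) ∈ F_p^{inv}} Σ_{f ∈ B_p^{I,J}} 1/#Aut(f)`"). The printed
statement integrates an invariant *function* and sums over the orbits with given invariants; this
file derives that form from the set form, on one tube:

* §1 `map_invPair_withDensity_mult` — the set form as an identity of measures on `ℤ_p²`: the
  push-forward along `(I, J)` of `#Aut_{ℤ_p} · μ_p|_A` is `(1 − p⁻²)|1/27|_p · vol₂|_{(I,J)(A ∩ S_r)}`;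
* §2 `setLIntegral_mul_autCard_eq_of_comp` — hence `∫⁻_A g(I,J) · #Aut_{ℤ_p} dμ_p =
  (1 − p⁻²)|1/27|_p ∫⁻_{(I,J)(A ∩ S_r)} g` for measurable `g` on `ℤ_p²`, and every invariant
  measurable `Ψ` on the tube is of the form `g ∘ (I, J)` there (`exists_measurable_comp_invPair_eq`:
  `(I, J)` restricted to the compact slice is a closed, hence measurable, embedding);
* §3 `setLIntegral_eq_mul_lintegral_tsum_orbits` — **the orbit form**: for invariant measurable
  `Φ ≥ 0` and invariant measurable `A ⊆ U_r`,
  `∫⁻_A Φ dμ_p = (1 − p⁻²)|1/27|_p ∫⁻_{ℤ_p²} Σ_{O ⊆ A orbit, (I,J)(O) = (I,J)} Φ(O)/#Aut_{ℤ_p}(O) d(I,J)`,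
  the sum having at most one term (the fibres of `(I, J)` in `U_r` are single orbits); the
  integrand on the right is measurable (`measurable_tsum_orbits`);
* §4 `lintegral_eq_mul_lintegral_tsum_orbits` — **the global orbit form**: for every invariant
  measurable `Φ : V_{ℤ_p} → [0, ∞]`,
  `∫⁻_{V_{ℤ_p}} Φ dμ_p = (1 − p⁻²)|1/27|_p ∫⁻_{ℤ_p²} Σ_{O ⊆ {Δ ≠ 0} orbit, (I,J)(O) = (I,J)} Φ(O)/#Aut_{ℤ_p}(O) d(I,J)`,
  by summing §3 over the countable family of disjoint invariant pieces of good tubes covering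
  `{Δ ≠ 0}` of `BinaryQuarticPadicOrbitMass.lean` (`exists_countable_tube_cover`, `piece`; the
  set form `μ_p(A) = … ∫ Σ 1/#Aut` there is the case `Φ = 1_A`).

This is the form in which the change of measure enters the computation of the local density
`∫ φ_p dμ_p = |2¹⁰/3³|_p M_p(V,F)` (Prop. 5.12 of arXiv v2 = Prop. 3.13 published) for the weight
`φ_p = 1/m_p` of the `2`-Selmer sieve (companion files).

## References

* M. Bhargava, A. Shankar, Ann. of Math. (2) 181 (2015) 191–242, Props. 3.11–3.12 of the
  published version; proof of Prop. 5.12 of arXiv:1006.1002v2 (p. 33).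
  [cite: BhargavaShankarAnnals2015, Prop. 5.12 proof (Jacobian change of variables; arXiv:1006.1002v2 numbering) = Props. 3.11–3.12 (published numbering)]
-/

noncomputable section

open scoped Classical Pointwise ENNReal NNReal Topology
open Matrix MulAction Set Metric MvPolynomial MeasureTheory Filter

namespace Literature.NumberTheory.EllipticCurves

namespace BinaryQuartic

open scoped IntegralAction

variable {p : ℕ} [Fact p.Prime]

local notation "G" => GL (Fin 2) ℤ_[p]

/-! ## §1 The tube theorem as an identity of measures on `ℤ_p²` -/

/-- An invariant set intersected with the preimage of a set of invariants is invariant. [folklore] -/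
theorem invariant_inter_preimage_invPair {A : Set (BinaryQuartic ℤ_[p])}
    (hA : ∀ g : G, ∀ f, g • f ∈ A ↔ f ∈ A) (T : Set (ℤ_[p] × ℤ_[p])) :
    ∀ g : G, ∀ f, g • f ∈ invPair ⁻¹' T ∩ A ↔ f ∈ invPair ⁻¹' T ∩ A := by
  intro g f
  simp only [mem_inter_iff, mem_preimage, invPair_glInt_smul, hA g f]

/-- `(I,J)((I,J)⁻¹ T ∩ A ∩ S) = T ∩ (I,J)(A ∩ S)`. [folklore] -/
theorem invPair_image_preimage_inter (T : Set (ℤ_[p] × ℤ_[p])) (A S : Set (BinaryQuartic ℤ_[p])) :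
    invPair '' (invPair ⁻¹' T ∩ A ∩ S) = T ∩ invPair '' (A ∩ S) := by
  ext y
  simp only [mem_image, mem_inter_iff, mem_preimage]
  constructor
  · rintro ⟨s, ⟨⟨hT, hA⟩, hS⟩, rfl⟩
    exact ⟨hT, s, ⟨hA, hS⟩, rfl⟩
  · rintro ⟨hT, s, ⟨hA, hS⟩, rfl⟩
    exact ⟨s, ⟨⟨hT, hA⟩, hS⟩, rfl⟩

/-- **The tube theorem as an identity of measures.** On a valid tube (`r ≥ 1`, `pʳ ∤ 2`,
`p⁻ʳ < |m(f₁,w)|_p`, `Δ ≠ 0` on the slice), for every invariant measurable `A ⊆ U_r`: the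
push-forward along `(I, J)` of the measure `N · μ_p|_A` (`N` the multiplicity function, `= #Aut_{ℤ_p}`
on the tube) is `(1 − p⁻²)|1/27|_p · vol₂` restricted to `(I,J)(A ∩ S_r)`.
[cite: BhargavaShankarAnnals2015, Props. 3.11–3.12 (published numbering)] -/
theorem map_invPair_withDensity_mult (f₁ w : BinaryQuartic ℤ_[p]) {r : ℕ} (hr : 1 ≤ r)
    (h2 : ¬ (p : ℤ_[p]) ^ r ∣ 2) (hm : (p : ℝ) ^ (-(r : ℤ)) < ‖f₁.sliceJac w‖)
    (hΔ : ∀ s ∈ slice f₁ w r, s.disc ≠ 0)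
    {A : Set (BinaryQuartic ℤ_[p])} (hAm : MeasurableSet A) (hA : ∀ g : G, ∀ f, g • f ∈ A ↔ f ∈ A)
    (hAU : A ⊆ tube f₁ w r) :
    Measure.map invPair ((volume.restrict A).withDensity fun f ↦ (mult f₁ w r f : ℝ≥0∞)) =
      (((p ^ 2 - 1 : ℕ) : ℝ≥0∞) / (p : ℝ≥0∞) ^ 2 * (‖(27 : ℤ_[p])‖₊ : ℝ≥0∞)⁻¹) • volume.restrict (invPair '' (A ∩ slice f₁ w r)) := by
  refine Measure.ext fun T hT ↦ ?_
  have hTm : MeasurableSet (invPair ⁻¹' T) := hT.preimage continuous_invPair.measurable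
  rw [Measure.map_apply continuous_invPair.measurable hT, withDensity_apply _ hTm,
    Measure.restrict_restrict hTm, Measure.smul_apply, Measure.restrict_apply hT, smul_eq_mul]
  -- the set `(I,J)⁻¹ T ∩ A` is invariant, measurable, inside the tube
  have hA'm : MeasurableSet (invPair ⁻¹' T ∩ A) := hTm.inter hAm
  have hA' := invariant_inter_preimage_invPair hA T
  have hA'U : invPair ⁻¹' T ∩ A ⊆ tube f₁ w r := inter_subset_right.trans hAU
  have h1 : ∫⁻ f in invPair ⁻¹' T ∩ A, (mult f₁ w r f : ℝ≥0∞) =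
      ∫⁻ f in invPair ⁻¹' T ∩ A, (autCard f : ℝ≥0∞) := by
    refine setLIntegral_congr_fun hA'm ?_
    intro f hf
    show (mult f₁ w r f : ℝ≥0∞) = (autCard f : ℝ≥0∞)
    rw [mult_eq_autCard hr h2 hm hΔ (hA'U hf)]
  rw [h1, setLIntegral_autCard_tube f₁ w hr h2 hm hΔ hA'm hA' hA'U, invPair_image_preimage_inter]

/-! ## §2 Integrating functions of the invariants against `#Aut_{ℤ_p} dμ_p` -/

/-- **`∫⁻_A g(I,J) · N dμ_p = (1 − p⁻²)|1/27|_p ∫⁻_{(I,J)(A ∩ S_r)} g`** for measurable `g ≥ 0` on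
`ℤ_p²` (valid tube, invariant measurable `A ⊆ U_r`). [cite: BhargavaShankarAnnals2015, Props. 3.11–3.12 (published numbering)] -/
theorem setLIntegral_comp_invPair_mul_mult (f₁ w : BinaryQuartic ℤ_[p]) {r : ℕ} (hr : 1 ≤ r)
    (h2 : ¬ (p : ℤ_[p]) ^ r ∣ 2) (hm : (p : ℝ) ^ (-(r : ℤ)) < ‖f₁.sliceJac w‖)
    (hΔ : ∀ s ∈ slice f₁ w r, s.disc ≠ 0)
    {A : Set (BinaryQuartic ℤ_[p])} (hAm : MeasurableSet A) (hA : ∀ g : G, ∀ f, g • f ∈ A ↔ f ∈ A)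
    (hAU : A ⊆ tube f₁ w r) {g : ℤ_[p] × ℤ_[p] → ℝ≥0∞} (hg : Measurable g) :
    ∫⁻ f in A, g (invPair f) * (mult f₁ w r f : ℝ≥0∞) =
      ((p ^ 2 - 1 : ℕ) : ℝ≥0∞) / (p : ℝ≥0∞) ^ 2 * (‖(27 : ℤ_[p])‖₊ : ℝ≥0∞)⁻¹ * ∫⁻ IJ in invPair '' (A ∩ slice f₁ w r), g IJ := by
  set ν : Measure (BinaryQuartic ℤ_[p]) := (volume.restrict A).withDensity fun f ↦ (mult f₁ w r f : ℝ≥0∞)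
    with hν
  calc ∫⁻ f in A, g (invPair f) * (mult f₁ w r f : ℝ≥0∞)
      = ∫⁻ f in A, ((fun f ↦ (mult f₁ w r f : ℝ≥0∞)) * (g ∘ invPair)) f := by
        refine lintegral_congr fun f ↦ ?_
        simp only [Pi.mul_apply, Function.comp_apply]
        rw [mul_comm]
    _ = ∫⁻ f, (g ∘ invPair) f ∂ν :=
        (lintegral_withDensity_eq_lintegral_mul _ (measurable_mult f₁ w r)
          (hg.comp continuous_invPair.measurable)).symm
    _ = ∫⁻ IJ, g IJ ∂(Measure.map invPair ν) := (lintegral_map hg continuous_invPair.measurable).symm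
    _ = ((p ^ 2 - 1 : ℕ) : ℝ≥0∞) / (p : ℝ≥0∞) ^ 2 * (‖(27 : ℤ_[p])‖₊ : ℝ≥0∞)⁻¹ * ∫⁻ IJ in invPair '' (A ∩ slice f₁ w r), g IJ := by
        rw [hν, map_invPair_withDensity_mult f₁ w hr h2 hm hΔ hAm hA hAU]
        simp only [lintegral_smul_measure, smul_eq_mul]

/-- **`∫⁻_A Ψ · #Aut_{ℤ_p} dμ_p = (1 − p⁻²)|1/27|_p ∫⁻_{(I,J)(A ∩ S_r)} g`** whenever `Ψ = g ∘ (I, J)`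
on `A` for a measurable `g ≥ 0` (valid tube, invariant measurable `A ⊆ U_r`; no measurability of
`Ψ` or of `#Aut_{ℤ_p}` is needed). [cite: BhargavaShankarAnnals2015, Props. 3.11–3.12 (published numbering)] -/
theorem setLIntegral_mul_autCard_eq_of_comp (f₁ w : BinaryQuartic ℤ_[p]) {r : ℕ} (hr : 1 ≤ r)
    (h2 : ¬ (p : ℤ_[p]) ^ r ∣ 2) (hm : (p : ℝ) ^ (-(r : ℤ)) < ‖f₁.sliceJac w‖)
    (hΔ : ∀ s ∈ slice f₁ w r, s.disc ≠ 0)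
    {A : Set (BinaryQuartic ℤ_[p])} (hAm : MeasurableSet A) (hA : ∀ g : G, ∀ f, g • f ∈ A ↔ f ∈ A)
    (hAU : A ⊆ tube f₁ w r) {Ψ : BinaryQuartic ℤ_[p] → ℝ≥0∞} {g : ℤ_[p] × ℤ_[p] → ℝ≥0∞}
    (hg : Measurable g) (hΨg : ∀ f ∈ A, Ψ f = g (invPair f)) :
    ∫⁻ f in A, Ψ f * (autCard f : ℝ≥0∞) = ((p ^ 2 - 1 : ℕ) : ℝ≥0∞) / (p : ℝ≥0∞) ^ 2 * (‖(27 : ℤ_[p])‖₊ : ℝ≥0∞)⁻¹ * ∫⁻ IJ in invPair '' (A ∩ slice f₁ w r), g IJ := by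
  rw [← setLIntegral_comp_invPair_mul_mult f₁ w hr h2 hm hΔ hAm hA hAU hg]
  refine setLIntegral_congr_fun hAm ?_
  intro f hf
  show Ψ f * (autCard f : ℝ≥0∞) = g (invPair f) * (mult f₁ w r f : ℝ≥0∞)
  rw [hΨg f hf, mult_eq_autCard hr h2 hm hΔ (hAU hf)]

/-- **Every measurable function on the slice is a measurable function of the invariants**: for
measurable `Ψ` there is a measurable `g` on `ℤ_p²` with `g(I(s), J(s)) = Ψ(s)` for all `s ∈ S_r`
(`p⁻ʳ < |m(f₁,w)|_p`): `(I, J)` restricted to the compact slice is a continuous injection, hence a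
closed embedding, hence a measurable embedding along which `Ψ` extends. [folklore] -/
theorem exists_measurable_comp_invPair_eq (f₁ w : BinaryQuartic ℤ_[p]) {r : ℕ}
    (hm : (p : ℝ) ^ (-(r : ℤ)) < ‖f₁.sliceJac w‖) {Ψ : BinaryQuartic ℤ_[p] → ℝ≥0∞} (hΨm : Measurable Ψ) :
    ∃ g : ℤ_[p] × ℤ_[p] → ℝ≥0∞, Measurable g ∧ ∀ s ∈ slice f₁ w r, g (invPair s) = Ψ s := by
  haveI : CompactSpace (slice f₁ w r) := isCompact_iff_compactSpace.mp (isCompact_slice f₁ w r)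
  let e : slice f₁ w r → ℤ_[p] × ℤ_[p] := fun s ↦ invPair (s : BinaryQuartic ℤ_[p])
  have he : Continuous e := continuous_invPair.comp continuous_subtype_val
  have hinj : Function.Injective e := fun s t h ↦
    Subtype.ext (invPair_injOn_slice f₁ w hm s.2 t.2 h)
  have hemb : MeasurableEmbedding e := (he.isClosedEmbedding hinj).measurableEmbedding
  obtain ⟨g, hg, hge⟩ := hemb.exists_measurable_extend (g := fun s ↦ Ψ (s : BinaryQuartic ℤ_[p]))
    (hΨm.comp measurable_subtype_coe) (fun _ ↦ ⟨0⟩)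
  exact ⟨g, hg, fun s hs ↦ congrFun hge ⟨s, hs⟩⟩

/-- An invariant function on the tube is a function of the invariants: if `g ∘ (I,J) = Ψ` on the
slice then `g ∘ (I,J) = Ψ` on the whole tube. [folklore] -/
theorem comp_invPair_eq_of_invariant {f₁ w : BinaryQuartic ℤ_[p]} {r : ℕ}
    {Ψ : BinaryQuartic ℤ_[p] → ℝ≥0∞} (hΨ : ∀ g : G, ∀ f, Ψ (g • f) = Ψ f)
    {g : ℤ_[p] × ℤ_[p] → ℝ≥0∞} (hgΨ : ∀ s ∈ slice f₁ w r, g (invPair s) = Ψ s)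
    {f : BinaryQuartic ℤ_[p]} (hf : f ∈ tube f₁ w r) : Ψ f = g (invPair f) := by
  obtain ⟨s, hs, k, rfl, hinv⟩ := exists_mem_slice_of_mem_tube hf
  rw [hΨ, hinv, hgΨ s hs]

/-- **`∫⁻_A Ψ · #Aut_{ℤ_p} dμ_p = (1 − p⁻²)|1/27|_p ∫⁻_{(I,J)(A ∩ S_r)} g`** for an invariant `Ψ` and
any `g` with `g ∘ (I, J) = Ψ` on the slice (valid tube, invariant measurable `A ⊆ U_r`).
[cite: BhargavaShankarAnnals2015, Props. 3.11–3.12 (published numbering)] -/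
theorem setLIntegral_mul_autCard_eq (f₁ w : BinaryQuartic ℤ_[p]) {r : ℕ} (hr : 1 ≤ r)
    (h2 : ¬ (p : ℤ_[p]) ^ r ∣ 2) (hm : (p : ℝ) ^ (-(r : ℤ)) < ‖f₁.sliceJac w‖)
    (hΔ : ∀ s ∈ slice f₁ w r, s.disc ≠ 0)
    {A : Set (BinaryQuartic ℤ_[p])} (hAm : MeasurableSet A) (hA : ∀ g : G, ∀ f, g • f ∈ A ↔ f ∈ A)
    (hAU : A ⊆ tube f₁ w r) {Ψ : BinaryQuartic ℤ_[p] → ℝ≥0∞} (hΨ : ∀ g : G, ∀ f, Ψ (g • f) = Ψ f)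
    {g : ℤ_[p] × ℤ_[p] → ℝ≥0∞} (hg : Measurable g) (hgΨ : ∀ s ∈ slice f₁ w r, g (invPair s) = Ψ s) :
    ∫⁻ f in A, Ψ f * (autCard f : ℝ≥0∞) = ((p ^ 2 - 1 : ℕ) : ℝ≥0∞) / (p : ℝ≥0∞) ^ 2 * (‖(27 : ℤ_[p])‖₊ : ℝ≥0∞)⁻¹ * ∫⁻ IJ in invPair '' (A ∩ slice f₁ w r), g IJ :=
  setLIntegral_mul_autCard_eq_of_comp f₁ w hr h2 hm hΔ hAm hA hAU hg
    fun _ hf ↦ comp_invPair_eq_of_invariant hΨ hgΨ (hAU hf)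

/-! ## §3 The orbit form -/

/-- On the tube the multiplicity function does not vanish (`f` lies in some translate of `W_r`).
[folklore] -/
theorem mult_ne_zero_of_mem_tube {f₁ w : BinaryQuartic ℤ_[p]} {r : ℕ} (hr : 1 ≤ r)
    {f : BinaryQuartic ℤ_[p]} (hf : f ∈ tube f₁ w r) : mult f₁ w r f ≠ 0 := by
  rw [tube_eq_iUnion hr, mem_iUnion] at hf
  obtain ⟨q, hq⟩ := hf
  rw [mult, Nat.card_ne_zero]
  exact ⟨⟨⟨q, hq⟩⟩, inferInstance⟩

/-- On a valid tube `#Aut_{ℤ_p}(f) ≠ 0` (the stabiliser is finite modulo scalars). [folklore] -/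
theorem autCard_ne_zero_of_mem_tube {f₁ w : BinaryQuartic ℤ_[p]} {r : ℕ} (hr : 1 ≤ r)
    (h2 : ¬ (p : ℤ_[p]) ^ r ∣ 2) (hm : (p : ℝ) ^ (-(r : ℤ)) < ‖f₁.sliceJac w‖)
    (hΔ : ∀ s ∈ slice f₁ w r, s.disc ≠ 0) {f : BinaryQuartic ℤ_[p]} (hf : f ∈ tube f₁ w r) :
    autCard f ≠ 0 := by
  rw [← mult_eq_autCard hr h2 hm hΔ hf]
  exact mult_ne_zero_of_mem_tube hr hf

/-- The value of an invariant function on an orbit: `⨆_{f ∈ G·s} Φ(f)/#Aut(f) = Φ(s)/#Aut(s)`.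
[folklore] -/
theorem iSup_orbit_eq {Φ : BinaryQuartic ℤ_[p] → ℝ≥0∞} (hΦ : ∀ g : G, ∀ f, Φ (g • f) = Φ f)
    (s : BinaryQuartic ℤ_[p]) :
    ⨆ f ∈ orbit G s, Φ f / (autCard f : ℝ≥0∞) = Φ s / (autCard s : ℝ≥0∞) := by
  apply le_antisymm
  · refine iSup₂_le fun f hf ↦ ?_
    obtain ⟨k, rfl⟩ := hf
    rw [hΦ, autCard_smul]
  · exact le_iSup₂_of_le s (mem_orbit_self s) le_rfl

/-- In an invariant `A` inside a tube, the orbits contained in `A` with prescribed invariants form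
a subsingleton (the fibres of `(I, J)` in `U_r` are single orbits). [folklore] -/
theorem subsingleton_orbits (f₁ w : BinaryQuartic ℤ_[p]) {r : ℕ}
    (hm : (p : ℝ) ^ (-(r : ℤ)) < ‖f₁.sliceJac w‖) {A : Set (BinaryQuartic ℤ_[p])}
    (hAU : A ⊆ tube f₁ w r) (IJ : ℤ_[p] × ℤ_[p]) :
    Subsingleton {O : Set (BinaryQuartic ℤ_[p]) // ∃ f ∈ A, invPair f = IJ ∧ orbit G f = O} := by
  refine ⟨fun O₁ O₂ ↦ Subtype.ext ?_⟩
  obtain ⟨f, hf, hfI, hfO⟩ := O₁.2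
  obtain ⟨f', hf', hf'I, hf'O⟩ := O₂.2
  rw [← hfO, ← hf'O]
  have h : f' ∈ orbit G f := mem_orbit_of_invPair_eq f₁ w hm (hAU hf) (hAU hf') (hfI.trans hf'I.symm)
  exact (orbit_eq_iff.mpr h).symm

/-- **The orbit sum on a piece of a tube**: for invariant `A ⊆ U_r`, invariant `Φ`, and `g` with
`g(I(s),J(s)) = Φ(s)/#Aut(s)` on the slice,
`Σ_{O ⊆ A orbit, (I,J)(O) = (I,J)} Φ(O)/#Aut_{ℤ_p}(O) = 1_{(I,J)(A ∩ S_r)}(I,J) · g(I,J)`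
(at most one orbit of `A` has the given invariants, namely that of the slice point).
[cite: BhargavaShankarAnnals2015, Props. 3.11–3.12 (published numbering)] -/
theorem tsum_orbits_eq_indicator (f₁ w : BinaryQuartic ℤ_[p]) {r : ℕ}
    (hm : (p : ℝ) ^ (-(r : ℤ)) < ‖f₁.sliceJac w‖) {A : Set (BinaryQuartic ℤ_[p])}
    (hA : ∀ g : G, ∀ f, g • f ∈ A ↔ f ∈ A) (hAU : A ⊆ tube f₁ w r)
    {Φ : BinaryQuartic ℤ_[p] → ℝ≥0∞} (hΦ : ∀ g : G, ∀ f, Φ (g • f) = Φ f)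
    {g : ℤ_[p] × ℤ_[p] → ℝ≥0∞} (hg : ∀ s ∈ slice f₁ w r, g (invPair s) = Φ s / (autCard s : ℝ≥0∞))
    (IJ : ℤ_[p] × ℤ_[p]) :
    (∑' O : {O : Set (BinaryQuartic ℤ_[p]) // ∃ f ∈ A, invPair f = IJ ∧ orbit G f = O},
        ⨆ f ∈ (O : Set (BinaryQuartic ℤ_[p])), Φ f / (autCard f : ℝ≥0∞)) =
      (invPair '' (A ∩ slice f₁ w r)).indicator g IJ := by
  haveI := subsingleton_orbits f₁ w hm hAU IJ
  by_cases hIJ : IJ ∈ invPair '' (A ∩ slice f₁ w r)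
  · rw [indicator_of_mem hIJ]
    obtain ⟨s, ⟨hsA, hsS⟩, rfl⟩ := hIJ
    let O₀ : {O : Set (BinaryQuartic ℤ_[p]) // ∃ f ∈ A, invPair f = invPair s ∧ orbit G f = O} :=
      ⟨orbit G s, s, hsA, rfl, rfl⟩
    rw [tsum_eq_single O₀ fun O hO ↦ absurd (Subsingleton.elim O O₀) hO]
    show ⨆ f ∈ orbit G s, Φ f / (autCard f : ℝ≥0∞) = g (invPair s)
    rw [iSup_orbit_eq hΦ, hg s hsS]
  · rw [indicator_of_notMem hIJ]
    haveI : IsEmpty {O : Set (BinaryQuartic ℤ_[p]) // ∃ f ∈ A, invPair f = IJ ∧ orbit G f = O} := by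
      refine ⟨fun O ↦ hIJ ?_⟩
      obtain ⟨f, hf, hfI, -⟩ := O.2
      obtain ⟨s, hs, k, rfl, hinv⟩ := exists_mem_slice_of_mem_tube (hAU hf)
      exact ⟨s, ⟨(hA k s).mp hf, hs⟩, by rw [← hinv, hfI]⟩
    rw [tsum_empty]

/-- **The orbit sum of a piece of a tube is a measurable function of the invariants.**
[cite: BhargavaShankarAnnals2015, Props. 3.11–3.12 (published numbering)] -/
theorem measurable_tsum_orbits (f₁ w : BinaryQuartic ℤ_[p]) {r : ℕ} (hr : 1 ≤ r)
    (h2 : ¬ (p : ℤ_[p]) ^ r ∣ 2) (hm : (p : ℝ) ^ (-(r : ℤ)) < ‖f₁.sliceJac w‖)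
    (hΔ : ∀ s ∈ slice f₁ w r, s.disc ≠ 0)
    {A : Set (BinaryQuartic ℤ_[p])} (hAm : MeasurableSet A) (hA : ∀ g : G, ∀ f, g • f ∈ A ↔ f ∈ A)
    (hAU : A ⊆ tube f₁ w r) {Φ : BinaryQuartic ℤ_[p] → ℝ≥0∞} (hΦm : Measurable Φ)
    (hΦ : ∀ g : G, ∀ f, Φ (g • f) = Φ f) :
    Measurable fun IJ : ℤ_[p] × ℤ_[p] ↦
      ∑' O : {O : Set (BinaryQuartic ℤ_[p]) // ∃ f ∈ A, invPair f = IJ ∧ orbit G f = O},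
        ⨆ f ∈ (O : Set (BinaryQuartic ℤ_[p])), Φ f / (autCard f : ℝ≥0∞) := by
  obtain ⟨g, hg, hgΦ⟩ := exists_measurable_comp_invPair_eq f₁ w hm
    (Ψ := fun f ↦ Φ f / (mult f₁ w r f : ℝ≥0∞)) (hΦm.div (measurable_mult f₁ w r))
  have hg' : ∀ s ∈ slice f₁ w r, g (invPair s) = Φ s / (autCard s : ℝ≥0∞) := fun s hs ↦ by
    rw [hgΦ s hs, mult_eq_autCard hr h2 hm hΔ (slice_subset_tube f₁ w r hs)]
  have heq : (fun IJ : ℤ_[p] × ℤ_[p] ↦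
      ∑' O : {O : Set (BinaryQuartic ℤ_[p]) // ∃ f ∈ A, invPair f = IJ ∧ orbit G f = O},
        ⨆ f ∈ (O : Set (BinaryQuartic ℤ_[p])), Φ f / (autCard f : ℝ≥0∞)) =
      (invPair '' (A ∩ slice f₁ w r)).indicator g :=
    funext fun IJ ↦ tsum_orbits_eq_indicator f₁ w hm hA hAU hΦ hg' IJ
  rw [heq]
  exact hg.indicator (measurableSet_invPair_image f₁ w hm hAm)

/-- **The tube theorem for functions (orbit form).** On a valid tube, for every invariant
measurable `A ⊆ U_r` and every invariant measurable `Φ : V_{ℤ_p} → [0, ∞]`,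

  `∫⁻_A Φ dμ_p = (1 − p⁻²)|1/27|_p · ∫⁻_{ℤ_p²} Σ_{O ⊆ A orbit, (I,J)(O) = (I,J)} Φ(O)/#Aut_{ℤ_p}(O) d(I,J)`

(Bhargava–Shankar: "`∫_{B_p^F} (1/#Aut(f)) df = |2/27|_p Vol(PGL₂(ℤ_p)) ∫ Σ_{f ∈ B_p^{I,J}} 1/#Aut(f)`",
restricted to one tube). [cite: BhargavaShankarAnnals2015, Props. 3.11–3.12 (published numbering); Prop. 5.12 proof (arXiv:1006.1002v2 numbering)] -/
theorem setLIntegral_eq_mul_lintegral_tsum_orbits (f₁ w : BinaryQuartic ℤ_[p]) {r : ℕ} (hr : 1 ≤ r)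
    (h2 : ¬ (p : ℤ_[p]) ^ r ∣ 2) (hm : (p : ℝ) ^ (-(r : ℤ)) < ‖f₁.sliceJac w‖)
    (hΔ : ∀ s ∈ slice f₁ w r, s.disc ≠ 0)
    {A : Set (BinaryQuartic ℤ_[p])} (hAm : MeasurableSet A) (hA : ∀ g : G, ∀ f, g • f ∈ A ↔ f ∈ A)
    (hAU : A ⊆ tube f₁ w r) {Φ : BinaryQuartic ℤ_[p] → ℝ≥0∞} (hΦm : Measurable Φ)
    (hΦ : ∀ g : G, ∀ f, Φ (g • f) = Φ f) :
    ∫⁻ f in A, Φ f =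
      ((p ^ 2 - 1 : ℕ) : ℝ≥0∞) / (p : ℝ≥0∞) ^ 2 * (‖(27 : ℤ_[p])‖₊ : ℝ≥0∞)⁻¹ * ∫⁻ IJ : ℤ_[p] × ℤ_[p],
        ∑' O : {O : Set (BinaryQuartic ℤ_[p]) // ∃ f ∈ A, invPair f = IJ ∧ orbit G f = O},
          ⨆ f ∈ (O : Set (BinaryQuartic ℤ_[p])), Φ f / (autCard f : ℝ≥0∞) := by
  obtain ⟨g, hg, hgΦ⟩ := exists_measurable_comp_invPair_eq f₁ w hm
    (Ψ := fun f ↦ Φ f / (mult f₁ w r f : ℝ≥0∞)) (hΦm.div (measurable_mult f₁ w r))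
  have hg' : ∀ s ∈ slice f₁ w r, g (invPair s) = Φ s / (autCard s : ℝ≥0∞) := fun s hs ↦ by
    rw [hgΦ s hs, mult_eq_autCard hr h2 hm hΔ (slice_subset_tube f₁ w r hs)]
  have hΨ : ∀ k : G, ∀ f, Φ (k • f) / (autCard (k • f) : ℝ≥0∞) = Φ f / (autCard f : ℝ≥0∞) := fun k f ↦ by
    rw [hΦ, autCard_smul]
  -- `Φ = (Φ/#Aut) · #Aut` on `A`
  have h1 : ∫⁻ f in A, Φ f = ∫⁻ f in A, Φ f / (autCard f : ℝ≥0∞) * (autCard f : ℝ≥0∞) := by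
    refine setLIntegral_congr_fun hAm fun f hf ↦ ?_
    show Φ f = Φ f / (autCard f : ℝ≥0∞) * (autCard f : ℝ≥0∞)
    rw [ENNReal.div_mul_cancel (Nat.cast_ne_zero.mpr (autCard_ne_zero_of_mem_tube hr h2 hm hΔ (hAU hf)))
      (ENNReal.natCast_ne_top _)]
  rw [h1, setLIntegral_mul_autCard_eq f₁ w hr h2 hm hΔ hAm hA hAU hΨ hg hg',
    ← lintegral_indicator (measurableSet_invPair_image f₁ w hm hAm)]
  congr 1
  refine lintegral_congr fun IJ ↦ ?_
  exact (tsum_orbits_eq_indicator f₁ w hm hA hAU hΦ hg' IJ).symm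

/-! ## §4 Globalisation over `V_{ℤ_p}`: the orbit form of the change of measure -/

/-- Forms in a good tube have nonzero discriminant. [folklore] -/
theorem disc_ne_zero_of_mem_tubeSet (D : TubeData p) {f : BinaryQuartic ℤ_[p]} (hf : f ∈ D.set) :
    f.disc ≠ 0 := by
  obtain ⟨g, s, hs, rfl⟩ := hf
  rw [disc_glInt_smul]
  exact D.disc_ne s hs

/-- For each `(I, J)`, the families of orbits of the disjoint invariant pieces are pairwise
disjoint (an orbit lies in a single piece). [folklore] -/
theorem pairwiseDisjoint_orbitSets (D : ℕ → TubeData p) (IJ : ℤ_[p] × ℤ_[p]) :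
    (univ : Set ℕ).PairwiseDisjoint fun n ↦
      {O : Set (BinaryQuartic ℤ_[p]) | ∃ f ∈ piece D n, invPair f = IJ ∧ orbit G f = O} := by
  intro m _ n _ hmn
  refine disjoint_left.mpr ?_
  rintro O ⟨f, hf, -, hfO⟩ ⟨f', hf', -, hf'O⟩
  have hff' : f' ∈ orbit G f := by rw [← orbit_eq_iff, hf'O, hfO]
  obtain ⟨g, rfl⟩ := hff'
  have hgf : g • f ∈ piece D m := (smul_mem_piece_iff D m g f).mpr hf
  exact hmn (by_contra fun h ↦ Set.disjoint_left.mp (disjoint_piece D h) hgf hf')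

/-- For each `(I, J)`, the orbits of `{Δ ≠ 0}` with invariants `(I, J)` are the union over the
pieces of the orbits of the pieces. [folklore] -/
theorem iUnion_orbitSets (D : ℕ → TubeData p) (hD : {f : BinaryQuartic ℤ_[p] | f.disc ≠ 0} ⊆ ⋃ n, (D n).set)
    (IJ : ℤ_[p] × ℤ_[p]) :
    (⋃ n, {O : Set (BinaryQuartic ℤ_[p]) | ∃ f ∈ piece D n, invPair f = IJ ∧ orbit G f = O}) =
      {O | ∃ f : BinaryQuartic ℤ_[p], f.disc ≠ 0 ∧ invPair f = IJ ∧ orbit G f = O} := by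
  ext O
  simp only [mem_iUnion, mem_setOf_eq]
  constructor
  · rintro ⟨n, f, hf, hI, hO⟩
    exact ⟨f, disc_ne_zero_of_mem_tubeSet (D n) hf.1, hI, hO⟩
  · rintro ⟨f, hfΔ, hI, hO⟩
    have hf : f ∈ ⋃ n, piece D n := by rw [iUnion_piece]; exact hD hfΔ
    obtain ⟨n, hn⟩ := mem_iUnion.mp hf
    exact ⟨n, f, hn, hI, hO⟩

/-- Regrouping the orbit sums of the pieces into the orbit sum of `{Δ ≠ 0}`. [folklore] -/
theorem tsum_tsum_orbits_piece_eq (D : ℕ → TubeData p) (hD : {f : BinaryQuartic ℤ_[p] | f.disc ≠ 0} ⊆ ⋃ n, (D n).set)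
    (F : Set (BinaryQuartic ℤ_[p]) → ℝ≥0∞) (IJ : ℤ_[p] × ℤ_[p]) :
    (∑' n : ℕ, ∑' O : {O : Set (BinaryQuartic ℤ_[p]) // ∃ f ∈ piece D n, invPair f = IJ ∧ orbit G f = O},
        F (O : Set (BinaryQuartic ℤ_[p]))) =
      ∑' O : {O : Set (BinaryQuartic ℤ_[p]) // ∃ f, f.disc ≠ 0 ∧ invPair f = IJ ∧ orbit G f = O},
        F (O : Set (BinaryQuartic ℤ_[p])) := by
  have key := ENNReal.tsum_biUnion (f := F) (pairwiseDisjoint_orbitSets D IJ)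
  have key' := tsum_congr_set_coe F (iUnion_orbitSets D hD IJ)
  exact (key.symm.trans key')

/-- **Bhargava–Shankar's `p`-adic change of measure, orbit form** (Props. 3.11–3.12 of the
published version; the "Jacobian change of variables" of the proof of Prop. 5.12 of arXiv v2).
For every `GL₂(ℤ_p)`-invariant measurable `Φ : V_{ℤ_p} → [0, ∞]`,

  `∫⁻_{V_{ℤ_p}} Φ dμ_p = (1 − p⁻²) · |1/27|_p · ∫⁻_{(I,J) ∈ ℤ_p²} Σ_{orbits 𝒪 ⊆ {Δ ≠ 0}, (I,J)(𝒪) = (I,J)} Φ(𝒪)/#Aut_{ℤ_p}(𝒪) d(I,J)`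

(`{Δ = 0}` is null; the sum over the orbits is an unconditional sum in `[0, ∞]`, the value of the
invariant function `Φ/#Aut_{ℤ_p}` on an orbit being rendered as `⨆` over its points).
[cite: BhargavaShankarAnnals2015, Props. 3.11–3.12 (published numbering); Prop. 5.12 proof (arXiv:1006.1002v2 numbering)] -/
theorem lintegral_eq_mul_lintegral_tsum_orbits {Φ : BinaryQuartic ℤ_[p] → ℝ≥0∞} (hΦm : Measurable Φ)
    (hΦ : ∀ g : G, ∀ f, Φ (g • f) = Φ f) :
    ∫⁻ f, Φ f =
      ((p ^ 2 - 1 : ℕ) : ℝ≥0∞) / (p : ℝ≥0∞) ^ 2 * (‖(27 : ℤ_[p])‖₊ : ℝ≥0∞)⁻¹ * ∫⁻ IJ : ℤ_[p] × ℤ_[p],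
        ∑' O : {O : Set (BinaryQuartic ℤ_[p]) // ∃ f, f.disc ≠ 0 ∧ invPair f = IJ ∧ orbit G f = O},
          ⨆ f ∈ (O : Set (BinaryQuartic ℤ_[p])), Φ f / (autCard f : ℝ≥0∞) := by
  obtain ⟨D, hD⟩ := exists_countable_tube_cover (p := p)
  -- Step 1: `⋃ pieces` has full measure
  have hcover : (⋃ n, piece D n)ᶜ ⊆ {f : BinaryQuartic ℤ_[p] | f.disc = 0} := by
    intro f hf
    by_contra hne
    exact hf (by rw [iUnion_piece]; exact hD hne)
  have hae : (⋃ n, piece D n) =ᵐ[volume] (univ : Set (BinaryQuartic ℤ_[p])) := by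
    rw [ae_eq_univ]
    exact measure_mono_null hcover volume_setOf_disc_eq_zero
  have h1 : ∫⁻ f, Φ f = ∫⁻ f in ⋃ n, piece D n, Φ f := by
    rw [← setLIntegral_univ, setLIntegral_congr hae]
  rw [h1, lintegral_iUnion (measurableSet_piece D) (disjoint_piece D)]
  -- Step 2: the orbit form on each piece
  have hpiece : ∀ n, ∫⁻ f in piece D n, Φ f =
      ((p ^ 2 - 1 : ℕ) : ℝ≥0∞) / (p : ℝ≥0∞) ^ 2 * (‖(27 : ℤ_[p])‖₊ : ℝ≥0∞)⁻¹ * ∫⁻ IJ : ℤ_[p] × ℤ_[p],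
        ∑' O : {O : Set (BinaryQuartic ℤ_[p]) // ∃ f ∈ piece D n, invPair f = IJ ∧ orbit G f = O},
          ⨆ f ∈ (O : Set (BinaryQuartic ℤ_[p])), Φ f / (autCard f : ℝ≥0∞) := fun n ↦
    setLIntegral_eq_mul_lintegral_tsum_orbits (D n).centre (unitForm (D n).κ) (D n).one_le (D n).not_dvd_two
      (D n).lt_norm (D n).disc_ne (measurableSet_piece D n) (smul_mem_piece_iff D n) (fun f hf ↦ hf.1) hΦm hΦ
  have hmeas : ∀ n, Measurable fun IJ : ℤ_[p] × ℤ_[p] ↦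
      ∑' O : {O : Set (BinaryQuartic ℤ_[p]) // ∃ f ∈ piece D n, invPair f = IJ ∧ orbit G f = O},
        ⨆ f ∈ (O : Set (BinaryQuartic ℤ_[p])), Φ f / (autCard f : ℝ≥0∞) := fun n ↦
    measurable_tsum_orbits (D n).centre (unitForm (D n).κ) (D n).one_le (D n).not_dvd_two
      (D n).lt_norm (D n).disc_ne (measurableSet_piece D n) (smul_mem_piece_iff D n) (fun f hf ↦ hf.1) hΦm hΦ
  rw [tsum_congr hpiece, ENNReal.tsum_mul_left, ← lintegral_tsum fun n ↦ (hmeas n).aemeasurable]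
  congr 1
  refine lintegral_congr fun IJ ↦ ?_
  -- Step 3: regroup the orbits of the pieces
  exact tsum_tsum_orbits_piece_eq D hD (fun O ↦ ⨆ f ∈ O, Φ f / (autCard f : ℝ≥0∞)) IJ

end BinaryQuartic

end Literature.NumberTheory.EllipticCurves

end
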